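import Summits.Ventures.Crystal3D.Theorems.StickyWulffConstantNoReconstructionGainJointBoundLevelGeom
import Summits.Ventures.Crystal3D.Theorems.StickyWulffConstantNoReconstructionGainJointBoundLevelCases
import Literature.Geometry.DiscreteGeometry.SphericalCodeContactGraph
import HarnessLib

/-!
# Joint level/support bound — the level-heavy row at `β = 1/20` (line `joint-level-support-bound`)

HONEST FRAMING. Part of the venture `Summits/Ventures/Crystal3D` (cell `crystal3d-full`), supports the
crux `NoReconstructionGain` (stmt-Ventures-19144, route `route-Ventures-StickyWulffConstant`), line
`joint-level-support-bound` (skeleton v2, `Cruxes/NoReconstructionGain/Lines/joint_level_support_bound.lean`).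
THE REGISTERED STUB `stub_jointBound_levelHeavy20`, by name: for a unit normal `ν` and a finite
kissing-separated set `U` of unit vectors, five `1/20`-level directions (`|⟪u, ν⟫| ≤ 1/20`) leave room
for at most three `1/2`-deep ones (`⟪u, ν⟫ ≤ -1/2`); (100) realises four deep and four level.

Method: azimuths about `ν` (`…JointBoundAzimuth`).  POLE CASE: the other deep directions are pinned to
depth `1/2` and the weighted level cycle (`jb_ruleA_bound`) is too long.  NO POLE: base the azimuths at
the SHALLOWEST deep direction, sort the other three, count the levels in the four deep arcs, and feed
(i) the certified deep gaps (`jb_arcA`), (ii) the one-dimensional packing of the levels inside each of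
the ten deep arcs (`jb_pack`, clearances `jb_arcC`), (iii) the weighted level cycle, into the finite
case check `jbTupleOK` (`jb_tuple_ok`, `jb_assembly`) over eight depth bands.

WHAT THIS IS NOT: the crux (residual `stub_adhesion_nonLayeredCore`); rung F-C1 not moved.
-/

noncomputable section

namespace Summit.Ventures.Crystal3D.Theorems

open Finset Real
open Literature.Geometry.DiscreteGeometry (exists_orthonormalBasis_third_eq_unit)
open Literature.Algebra.EuclideanLattices (inner_fin_three norm_sq_fin_three)
open scoped InnerProductSpace

/-- Consecutive bands share edges: the upper edge of a band is at most the lower edge of any later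
band. -/
theorem jbHi_le_jbLo : ∀ b, b < 8 → ∀ b', b' < 8 → b < b' → jbHi b ≤ jbLo b' := by
  decide +kernel

/-- A monotone depth-band assignment on `[1/2, 1]`: every depth gets a band `< 8` containing it, and
deeper directions get bands with no smaller index. -/
theorem jb_exists_bandFun : ∃ band : ℝ → ℕ,
    (∀ x : ℝ, 1 / 2 ≤ x → x ≤ 1 →
      band x < 8 ∧ ((jbLo (band x) : ℚ) : ℝ) ≤ x ∧ x ≤ ((jbHi (band x) : ℚ) : ℝ)) ∧
    (∀ x y : ℝ, 1 / 2 ≤ x → y ≤ 1 → x ≤ y → band x ≤ band y) := by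
  let band : ℝ → ℕ := fun x => if x < 14 / 25 then 0 else if x < 31 / 50 then 1
    else if x < 33 / 50 then 2 else if x < 7 / 10 then 3 else if x < 37 / 50 then 4
    else if x < 39 / 50 then 5 else if x < 83 / 100 then 6 else 7
  have hval : ∀ x : ℝ, 1 / 2 ≤ x → x ≤ 1 →
      band x < 8 ∧ ((jbLo (band x) : ℚ) : ℝ) ≤ x ∧ x ≤ ((jbHi (band x) : ℚ) : ℝ) := by
    intro x hx1 hx2
    simp only [band]
    split_ifs <;> (refine ⟨by omega, ?_, ?_⟩ <;> norm_num [jbLo, jbHi] <;> linarith)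
  refine ⟨band, hval, fun x y hx hy hxy => ?_⟩
  by_contra h
  push Not at h
  have hvx := hval x hx (hxy.trans hy)
  have hvy := hval y (hx.trans hxy) hy
  have hedge := jbHi_le_jbLo (band y) hvy.1 (band x) hvx.1 h
  have hedgeR : ((jbHi (band y) : ℚ) : ℝ) ≤ ((jbLo (band x) : ℚ) : ℝ) := by exact_mod_cast hedge
  have hxy' : x = y := le_antisymm hxy (by linarith [hvy.2.2, hvx.2.1])
  rw [hxy'] at h
  exact lt_irrefl _ h

/-- **Level-heavy row, coordinate form.**  `F` a finite set of unit vectors of `ℝ³` with pairwise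
inner products `≤ 1/2`; if at least five have third coordinate in `[-1/20, 1/20]` then at most three
have third coordinate `≤ -1/2`. -/
theorem jointBound_levelHeavy20_coord (F : Finset (EuclideanSpace ℝ (Fin 3)))
    (hn : ∀ u ∈ F, ‖u‖ = 1) (hsep : ∀ u ∈ F, ∀ v ∈ F, u ≠ v → ⟪u, v⟫_ℝ ≤ 1 / 2)
    (h5 : 5 ≤ (F.filter fun u => |u 2| ≤ 1 / 20).card) :
    (F.filter fun u => u 2 ≤ -(1 / 2)).card ≤ 3 := by
  classical
  set D := F.filter fun u => u 2 ≤ -(1 / 2) with hD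
  set L := F.filter fun u => |u 2| ≤ 1 / 20 with hL
  have hpi := Real.pi_lt_d4
  have hpi3 := Real.pi_gt_three
  have hmemD : ∀ u ∈ D, u ∈ F ∧ u 2 ≤ -(1 / 2) := fun u hu => by simpa [hD] using hu
  have hmemL : ∀ u ∈ L, u ∈ F ∧ |u 2| ≤ 1 / 20 := fun u hu => by simpa [hL] using hu
  have hco : ∀ u ∈ F, u 0 ^ 2 + u 1 ^ 2 + u 2 ^ 2 = 1 := fun u hu => by
    rw [← norm_sq_fin_three, hn u hu]; norm_num
  by_contra H
  push Not at H
  obtain ⟨L5, hL5L, hL5card⟩ := exists_subset_card_eq h5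
  obtain ⟨D4, hD4D, hD4card⟩ := exists_subset_card_eq (show 4 ≤ D.card by omega)
  have hL5F : ∀ u ∈ L5, u ∈ F := fun u hu => (hmemL u (hL5L hu)).1
  have hL5lev : ∀ u ∈ L5, |u 2| ≤ 1 / 20 := fun u hu => (hmemL u (hL5L hu)).2
  have hD4F : ∀ u ∈ D4, u ∈ F := fun u hu => (hmemD u (hD4D hu)).1
  have hD4z : ∀ u ∈ D4, u 2 ≤ -(1 / 2) := fun u hu => (hmemD u (hD4D hu)).2
  have hDL : ∀ u ∈ D4, ∀ v ∈ L5, u ≠ v := by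
    intro u hu v hv heq
    have h1 := hD4z u hu; have h2 := (abs_le.1 (hL5lev v hv)).1; rw [heq] at h1; linarith
  have hTLL : ((jbTLL : ℕ) : ℝ) = 10408 := by norm_num [jbTLL]
  by_cases hpole : ∃ u₀ ∈ D4, u₀ 0 ^ 2 + u₀ 1 ^ 2 = 0
  · /- POLE CASE: three pinned deep directions and the weighted level cycle -/
    obtain ⟨u₀, hu₀, hu₀0⟩ := hpole
    have hx0 : u₀ 0 = 0 := by nlinarith [sq_nonneg (u₀ 0), sq_nonneg (u₀ 1)]
    have hy0 : u₀ 1 = 0 := by nlinarith [sq_nonneg (u₀ 0), sq_nonneg (u₀ 1)]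
    have hz0 : u₀ 2 = -1 := by
      have h1 := hco u₀ (hD4F u₀ hu₀); have h2 := hD4z u₀ hu₀; nlinarith
    set S := D4.erase u₀ with hS
    have hScard : S.card = 3 := by rw [hS, card_erase_of_mem hu₀, hD4card]
    have hpin : ∀ v ∈ S, v 2 = -(1 / 2) := by
      intro v hv
      have hvD : v ∈ D4 := mem_of_mem_erase hv
      have h := hsep u₀ (hD4F u₀ hu₀) v (hD4F v hvD) (ne_of_mem_erase hv).symm
      rw [inner_fin_three, hx0, hy0, hz0] at h
      linarith [hD4z v hvD]
    have key := jb_ruleA_bound F hn hsep L5 (fun u hu => hL5F u hu) hL5lev hL5card S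
      (fun u hu => hD4F u (mem_of_mem_erase hu)) (fun u hu => hD4z u (mem_of_mem_erase hu))
      (fun u hu => by nlinarith [hco u (hD4F u (mem_of_mem_erase hu)), hpin u hu]) (fun _ => 0)
      (fun u hu => ⟨by norm_num, by rw [hpin u hu]; norm_num [jbHi]⟩)
      (fun u _ => by decide)
    simp only [sum_const, hScard, nsmul_eq_mul] at key
    norm_num [jbTLL, jbTC] at key
    linarith
  /- NO POLE -/
  push Not at hpole
  have hD4ρ : ∀ u ∈ D4, 0 < u 0 ^ 2 + u 1 ^ 2 := fun u hu =>
    lt_of_le_of_ne (by positivity) (Ne.symm (hpole u hu))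
  -- the shallowest deep direction is the base
  obtain ⟨p, hp, hpmax⟩ := exists_max_image D4 (fun u => u 2) (card_pos.1 (by omega))
  have hpF := hD4F p hp
  obtain ⟨ρ, θ, hρ, hθ, hθp, -, hθpair⟩ := exists_azimuth p (hD4ρ p hp)
  have hzρ : ∀ u ∈ F, u 2 ^ 2 + ρ u ^ 2 = 1 := fun u hu => by rw [(hρ u).2]; linarith [hco u hu]
  have hρpos : ∀ u ∈ D4, 0 < ρ u := fun u hu => by
    have h2 := (hρ u).2; have h0 := (hρ u).1; have := hD4ρ u hu
    by_contra hle; have : ρ u = 0 := le_antisymm (not_lt.1 hle) h0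
    rw [this] at h2; simp at h2; linarith
  have hpair : ∀ u ∈ F, ∀ v ∈ F, u ≠ v → ∀ x : ℝ, Real.cos x = Real.cos (θ u - θ v) →
      ρ u * ρ v * Real.cos x + u 2 * v 2 ≤ 1 / 2 := by
    intro u hu v hv huv x hx
    rw [hx, hθpair u v, ← inner_fin_three]; exact hsep u hu v hv huv
  have hcos_symm : ∀ a b : ℝ, Real.cos (a - b) = Real.cos (b - a) := fun a b => by
    rw [← Real.cos_neg, neg_sub]
  -- depth bands
  have hdepth : ∀ u ∈ D4, 1 / 2 ≤ -u 2 ∧ -u 2 ≤ 1 := fun u hu =>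
    ⟨by linarith [hD4z u hu], by nlinarith [hco u (hD4F u hu)]⟩
  obtain ⟨band, hbandval, hbandmono⟩ := jb_exists_bandFun
  let bd : EuclideanSpace ℝ (Fin 3) → ℕ := fun u => band (-u 2)
  have hbd8 : ∀ u ∈ D4, bd u < 8 := fun u hu => (hbandval _ (hdepth u hu).1 (hdepth u hu).2).1
  have hbdlo : ∀ u ∈ D4, ((jbLo (bd u) : ℚ) : ℝ) ≤ -u 2 := fun u hu =>
    (hbandval _ (hdepth u hu).1 (hdepth u hu).2).2.1
  have hbdhi : ∀ u ∈ D4, -u 2 ≤ ((jbHi (bd u) : ℚ) : ℝ) := fun u hu =>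
    (hbandval _ (hdepth u hu).1 (hdepth u hu).2).2.2
  have hbdge : ∀ u ∈ D4, bd p ≤ bd u := fun u hu =>
    hbandmono _ _ (hdepth p hp).1 (hdepth u hu).2 (by linarith [hpmax u hu])
  -- clearance and separation facts
  have hclr : ∀ d ∈ D4, ∀ u ∈ L5, ∀ x : ℝ, 0 ≤ x → Real.cos x = Real.cos (θ u - θ d) →
      ((jbTC (bd d) : ℕ) : ℝ) / 10000 ≤ x := by
    intro d hd u hu x hx hcx
    have hs := hpair u (hL5F u hu) d (hD4F d hd) (hDL d hd u hu).symm x hcx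
    exact jb_arcC (bd d) (hbd8 d hd) (d 2) (u 2) (ρ d) (ρ u) x (hD4z d hd)
      (by linarith [hbdhi d hd]) (hL5lev u hu) (hρ d).1 (hρ u).1 (hzρ d (hD4F d hd))
      (hzρ u (hL5F u hu)) hx (by linarith)
  have hLL : ∀ u ∈ L5, ∀ v ∈ L5, u ≠ v → ((jbTLL : ℕ) : ℝ) / 10000 < |θ u - θ v| := by
    intro u hu v hv huv
    have hs := hpair u (hL5F u hu) v (hL5F v hv) huv |θ u - θ v| (Real.cos_abs _)
    exact jb_arcLL (u 2) (v 2) (ρ u) (ρ v) _ (hL5lev u hu) (hL5lev v hv) (hρ u).1 (hρ v).1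
      (hzρ u (hL5F u hu)) (hzρ v (hL5F v hv)) (abs_nonneg _) hs
  have hdd : ∀ d ∈ D4, ∀ d' ∈ D4, d ≠ d' → ∀ x : ℝ, 0 ≤ x → Real.cos x = Real.cos (θ d' - θ d) →
      ((jbTA (bd d) (bd d') : ℕ) : ℝ) / 10000 < x := by
    intro d hd d' hd' hne x hx hcx
    have hs := hpair d' (hD4F d' hd') d (hD4F d hd) hne.symm x hcx
    exact jb_arcA (bd d) (bd d') (hbd8 d hd) (hbd8 d' hd') (d 2) (d' 2) (ρ d) (ρ d') x
      (by linarith [hbdlo d hd]) (by linarith [hbdlo d' hd']) (hρpos d hd) (hρpos d' hd')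
      (hzρ d (hD4F d hd)) (hzρ d' (hD4F d' hd')) hx (by linarith)
  -- the three other deep directions in azimuthal order
  set D3 := D4.erase p with hD3
  have hD3card : D3.card = 3 := by rw [hD3, card_erase_of_mem hp, hD4card]
  obtain ⟨e, hmono⟩ := exists_sorted_equiv D3 θ
  have hi3 : ∀ i, i < 3 → i < D3.card := fun i h => by omega
  obtain ⟨q, hqe⟩ : ∃ q : ℕ → EuclideanSpace ℝ (Fin 3),
      ∀ i (h : i < 3), q i = (e ⟨i, hi3 i h⟩ : EuclideanSpace ℝ (Fin 3)) :=
    ⟨fun i => if h : i < 3 then (e ⟨i, hi3 i h⟩ : EuclideanSpace ℝ (Fin 3)) else p, fun i h => dif_pos h⟩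
  have hqD3 : ∀ i, i < 3 → q i ∈ D3 := fun i h => by rw [hqe i h]; exact (e ⟨i, hi3 i h⟩).2
  have hqD4 : ∀ i, i < 3 → q i ∈ D4 := fun i h => mem_of_mem_erase (hqD3 i h)
  have hqp : ∀ i, i < 3 → q i ≠ p := fun i h => ne_of_mem_erase (hqD3 i h)
  have hqne : ∀ i j, i < 3 → j < 3 → i ≠ j → q i ≠ q j := by
    intro i j hi hj hij heq
    rw [hqe i hi, hqe j hj] at heq
    have := e.injective (Subtype.ext heq)
    simp at this; exact hij this
  have hmono' : ∀ i j, i ≤ j → j < 3 → θ (q i) ≤ θ (q j) := by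
    intro i j hij hj
    rw [hqe i (by omega), hqe j hj]
    exact hmono (show (⟨i, hi3 i (by omega)⟩ : Fin D3.card) ≤ ⟨j, hi3 j hj⟩ by simp [Fin.le_def, hij])
  -- azimuths
  have ht1 : 0 ≤ θ (q 0) := (hθ _).1
  have h12 : θ (q 0) ≤ θ (q 1) := hmono' 0 1 (by omega) (by omega)
  have h23 : θ (q 1) ≤ θ (q 2) := hmono' 1 2 (by omega) (by omega)
  have ht3 : θ (q 2) < 2 * π := (hθ _).2
  -- level counts
  set k0 := (L5.filter fun u => 0 ≤ θ u ∧ θ u < θ (q 0)).card with hk0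
  set k1 := (L5.filter fun u => θ (q 0) ≤ θ u ∧ θ u < θ (q 1)).card with hk1
  set k2 := (L5.filter fun u => θ (q 1) ≤ θ u ∧ θ u < θ (q 2)).card with hk2
  set k3 := (L5.filter fun u => θ (q 2) ≤ θ u ∧ θ u < 2 * π).card with hk3
  have hall : (L5.filter fun u => 0 ≤ θ u ∧ θ u < 2 * π) = L5 :=
    filter_true_of_mem fun u _ => ⟨(hθ u).1, (hθ u).2⟩
  have hK02 : (L5.filter fun u => 0 ≤ θ u ∧ θ u < θ (q 1)).card = k0 + k1 :=
    jb_card_split L5 θ 0 _ _ ht1 h12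
  have hK03 : (L5.filter fun u => 0 ≤ θ u ∧ θ u < θ (q 2)).card = k0 + k1 + k2 := by
    rw [jb_card_split L5 θ 0 (θ (q 1)) _ (by linarith) h23, hK02]
  have hK04 : (L5.filter fun u => 0 ≤ θ u ∧ θ u < 2 * π).card = k0 + k1 + k2 + k3 := by
    rw [jb_card_split L5 θ 0 (θ (q 2)) _ (by linarith) ht3.le, hK03]
  have hK13 : (L5.filter fun u => θ (q 0) ≤ θ u ∧ θ u < θ (q 2)).card = k1 + k2 :=
    jb_card_split L5 θ _ _ _ h12 h23
  have hK14 : (L5.filter fun u => θ (q 0) ≤ θ u ∧ θ u < 2 * π).card = k1 + k2 + k3 := by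
    rw [jb_card_split L5 θ _ (θ (q 2)) _ (by linarith) ht3.le, hK13]
  have hK24 : (L5.filter fun u => θ (q 1) ≤ θ u ∧ θ u < 2 * π).card = k2 + k3 :=
    jb_card_split L5 θ _ _ _ h23 ht3.le
  have hsum5 : k0 + k1 + k2 + k3 = 5 := by rw [← hK04, hall, hL5card]
  -- clearances at the ends of azimuth intervals
  have hlo_p : ∀ b : ℝ, ∀ u ∈ L5, 0 ≤ θ u → θ u < b →
      0 + ((jbTC (bd p) : ℕ) : ℝ) / 10000 ≤ θ u := by
    intro b u hu h0 _
    have := hclr p hp u hu (θ u) h0 (by rw [hθp, sub_zero])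
    linarith
  have hlo_q : ∀ i, i < 3 → ∀ b : ℝ, ∀ u ∈ L5, θ (q i) ≤ θ u → θ u < b →
      θ (q i) + ((jbTC (bd (q i)) : ℕ) : ℝ) / 10000 ≤ θ u := by
    intro i hi b u hu h0 _
    have := hclr (q i) (hqD4 i hi) u hu (θ u - θ (q i)) (by linarith) rfl
    linarith
  have hhi_q : ∀ i, i < 3 → ∀ a : ℝ, ∀ u ∈ L5, a ≤ θ u → θ u < θ (q i) →
      θ u ≤ θ (q i) - ((jbTC (bd (q i)) : ℕ) : ℝ) / 10000 := by
    intro i hi a u hu _ h1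
    have := hclr (q i) (hqD4 i hi) u hu (θ (q i) - θ u) (by linarith) (hcos_symm _ _)
    linarith
  have hhi_end : ∀ a : ℝ, ∀ u ∈ L5, a ≤ θ u → θ u < 2 * π →
      θ u ≤ 2 * π - ((jbTC (bd p) : ℕ) : ℝ) / 10000 := by
    intro a u hu _ h1
    have := hclr p hp u hu (2 * π - θ u) (by linarith)
      (by rw [Real.cos_two_pi_sub, hθp, sub_zero])
    linarith
  -- the ten packing facts
  have P01 := jb_pack L5 θ 0 (θ (q 0)) (jbTC (bd p)) (jbTC (bd (q 0))) hLL (hlo_p _)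
    (hhi_q 0 (by omega) _)
  have P02 := jb_pack L5 θ 0 (θ (q 1)) (jbTC (bd p)) (jbTC (bd (q 1))) hLL (hlo_p _)
    (hhi_q 1 (by omega) _)
  have P03 := jb_pack L5 θ 0 (θ (q 2)) (jbTC (bd p)) (jbTC (bd (q 2))) hLL (hlo_p _)
    (hhi_q 2 (by omega) _)
  have P04 := jb_pack L5 θ 0 (2 * π) (jbTC (bd p)) (jbTC (bd p)) hLL (hlo_p _) (hhi_end _)
  have P12 := jb_pack L5 θ (θ (q 0)) (θ (q 1)) (jbTC (bd (q 0))) (jbTC (bd (q 1))) hLL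
    (hlo_q 0 (by omega) _) (hhi_q 1 (by omega) _)
  have P13 := jb_pack L5 θ (θ (q 0)) (θ (q 2)) (jbTC (bd (q 0))) (jbTC (bd (q 2))) hLL
    (hlo_q 0 (by omega) _) (hhi_q 2 (by omega) _)
  have P14 := jb_pack L5 θ (θ (q 0)) (2 * π) (jbTC (bd (q 0))) (jbTC (bd p)) hLL
    (hlo_q 0 (by omega) _) (hhi_end _)
  have P23 := jb_pack L5 θ (θ (q 1)) (θ (q 2)) (jbTC (bd (q 1))) (jbTC (bd (q 2))) hLL
    (hlo_q 1 (by omega) _) (hhi_q 2 (by omega) _)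
  have P24 := jb_pack L5 θ (θ (q 1)) (2 * π) (jbTC (bd (q 1))) (jbTC (bd p)) hLL
    (hlo_q 1 (by omega) _) (hhi_end _)
  have P34 := jb_pack L5 θ (θ (q 2)) (2 * π) (jbTC (bd (q 2))) (jbTC (bd p)) hLL
    (hlo_q 2 (by omega) _) (hhi_end _)
  rw [hK02] at P02
  rw [hK03] at P03
  rw [hK04] at P04
  rw [hK13] at P13
  rw [hK14] at P14
  rw [hK24] at P24
  -- deep gaps
  have A0 := hdd p hp (q 0) (hqD4 0 (by omega)) (hqp 0 (by omega)).symm (θ (q 0)) ht1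
    (by rw [hθp, sub_zero])
  have A1 := hdd (q 0) (hqD4 0 (by omega)) (q 1) (hqD4 1 (by omega)) (hqne 0 1 (by omega) (by omega) (by omega))
    (θ (q 1) - θ (q 0)) (by linarith) rfl
  have A2 := hdd (q 1) (hqD4 1 (by omega)) (q 2) (hqD4 2 (by omega)) (hqne 1 2 (by omega) (by omega) (by omega))
    (θ (q 2) - θ (q 1)) (by linarith) rfl
  have A3 := hdd (q 2) (hqD4 2 (by omega)) p hp (hqp 2 (by omega)) (2 * π - θ (q 2)) (by linarith)
    (by rw [Real.cos_two_pi_sub, hθp, zero_sub, Real.cos_neg])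
  -- rule A
  set S := D4.filter fun u => jbTLL ≤ 2 * jbTC (bd u) with hSdef
  have hRA0 := jb_ruleA_bound F hn hsep L5 (fun u hu => hL5F u hu) hL5lev hL5card S
    (fun u hu => hD4F u (mem_filter.1 hu).1) (fun u hu => hD4z u (mem_filter.1 hu).1)
    (fun u hu => hD4ρ u (mem_filter.1 hu).1) bd
    (fun u hu => ⟨hbd8 u (mem_filter.1 hu).1, by linarith [hbdhi u (mem_filter.1 hu).1]⟩)
    (fun u hu => (mem_filter.1 hu).2)
  have hSsum : ∑ u ∈ S, (2 * ((jbTC (bd u) : ℕ) : ℝ) - jbTLL) =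
      ∑ u ∈ D4, max 0 (2 * ((jbTC (bd u) : ℕ) : ℝ) - jbTLL) := by
    rw [hSdef, sum_filter]
    refine sum_congr rfl fun u _ => ?_
    split_ifs with h
    · rw [max_eq_right]; have : ((jbTLL : ℕ) : ℝ) ≤ 2 * ((jbTC (bd u) : ℕ) : ℝ) := by exact_mod_cast h
      linarith
    · rw [max_eq_left]; push Not at h
      have : 2 * ((jbTC (bd u) : ℕ) : ℝ) < ((jbTLL : ℕ) : ℝ) := by exact_mod_cast h
      linarith
  have hD4sum : ∀ g : EuclideanSpace ℝ (Fin 3) → ℝ,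
      ∑ u ∈ D4, g u = g p + g (q 0) + g (q 1) + g (q 2) := by
    intro g
    rw [← sum_erase_add D4 g hp, ← hD3]
    have h1 : ∑ u ∈ D3, g u = ∑ i : Fin D3.card, g (e i : EuclideanSpace ℝ (Fin 3)) := by
      rw [← Finset.sum_coe_sort D3 g]; exact (e.sum_comp (fun u : D3 => g (u : EuclideanSpace ℝ (Fin 3)))).symm
    rw [h1]
    have h2 : ∑ i : Fin D3.card, g (e i : EuclideanSpace ℝ (Fin 3)) = ∑ i ∈ Finset.range D3.card,
        (fun j => if h : j < 3 then g (q j) else 0) i := by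
      rw [Finset.sum_range]
      refine sum_congr rfl fun i _ => ?_
      have hi : (i : ℕ) < 3 := by omega
      rw [dif_pos hi, hqe i hi]
    rw [h2, hD3card]
    simp [Finset.sum_range_succ]
    ring
  rw [hSsum, hD4sum] at hRA0
  -- assemble
  refine jb_assembly (bd p) (bd (q 0)) (bd (q 1)) (bd (q 2)) k0 k1 k2 k3
    (10000 * θ (q 0)) (10000 * θ (q 1)) (10000 * θ (q 2)) (by omega) (by omega) (by omega) (by omega)
    (by omega) ?_ ?_ ?_ ?_ ?_ ?_ ?_ ?_ ?_ ?_ ?_ ?_ ?_ ?_ ?_ ?_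
  · exact jb_tuple_ok _ _ _ _ (hbd8 p hp) (hbd8 _ (hqD4 0 (by omega))) (hbd8 _ (hqD4 1 (by omega)))
      (hbd8 _ (hqD4 2 (by omega))) (hbdge _ (hqD4 0 (by omega))) (hbdge _ (hqD4 1 (by omega)))
      (hbdge _ (hqD4 2 (by omega)))
  · have h := A0; rw [div_lt_iff₀ (by norm_num)] at h; linarith
  · have h := A1; rw [div_lt_iff₀ (by norm_num)] at h; linarith
  · have h := A2; rw [div_lt_iff₀ (by norm_num)] at h; linarith
  · have h := A3; rw [div_lt_iff₀ (by norm_num)] at h; linarith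
  · intro h; have := P01 (by rw [← hk0]; exact h); rw [← hk0] at this; linarith
  · intro h; have := P02 h; linarith
  · intro h; have := P03 h; linarith
  · intro h; have := P04 h; linarith
  · intro h; have := P12 (by rw [← hk1]; exact h); rw [← hk1] at this; linarith
  · intro h; have := P13 h; linarith
  · intro h; have := P14 h; linarith
  · intro h; have := P23 (by rw [← hk2]; exact h); rw [← hk2] at this; linarith
  · intro h; have := P24 h; linarith
  · intro h; have := P34 (by rw [← hk3]; exact h); rw [← hk3] at this; linarith
  · unfold jbRA; push_cast; linarith [hRA0]

/-! ### The registered stub -/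

/-- **Registered stub `stub_jointBound_levelHeavy20` (line `joint-level-support-bound`, skeleton v2).**
Level-heavy regime of the joint level/support bound at `β = 1/20`: five `1/20`-level directions of
a kissing-separated set of unit vectors leave room for at most three `1/2`-deep ones.  Transport of
`jointBound_levelHeavy20_coord` along an orthonormal frame with third vector `ν`. -/
theorem stub_jointBound_levelHeavy20 :
    ∀ ν : EuclideanSpace ℝ (Fin 3), ‖ν‖ = 1 → ∀ U : Finset (EuclideanSpace ℝ (Fin 3)),
      (∀ u ∈ U, ‖u‖ = 1) → (∀ u ∈ U, ∀ w ∈ U, u ≠ w → ⟪u, w⟫_ℝ ≤ 1 / 2) →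
      5 ≤ (U.filter fun u => |⟪u, ν⟫_ℝ| ≤ 1 / 20).card →
      (U.filter fun u => ⟪u, ν⟫_ℝ ≤ -(1 / 2)).card ≤ 3 := by
  classical
  intro ν hν U hU hsep h5
  obtain ⟨b, hb⟩ := exists_orthonormalBasis_third_eq_unit hν
  have hcoord : ∀ u, (b.repr u : EuclideanSpace ℝ (Fin 3)) 2 = ⟪u, ν⟫_ℝ := fun u => by
    rw [show (b.repr u : EuclideanSpace ℝ (Fin 3)) 2 = ⟪b 2, u⟫_ℝ from b.repr_apply_apply u 2, hb,
      real_inner_comm]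
  have hinj : Function.Injective (fun u => (b.repr u : EuclideanSpace ℝ (Fin 3))) :=
    fun u w h => b.repr.injective h
  set F := U.image (fun u => (b.repr u : EuclideanSpace ℝ (Fin 3))) with hF
  have hdeep : (U.filter fun u => ⟪u, ν⟫_ℝ ≤ -(1 / 2)).card =
      (F.filter fun u => u 2 ≤ -(1 / 2)).card := by
    rw [hF, filter_image, card_image_of_injective _ hinj]
    congr 1
    exact filter_congr fun u _ => by simp only [hcoord]
  have hlevel : (U.filter fun u => |⟪u, ν⟫_ℝ| ≤ 1 / 20).card =
      (F.filter fun u => |u 2| ≤ 1 / 20).card := by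
    rw [hF, filter_image, card_image_of_injective _ hinj]
    congr 1
    exact filter_congr fun u _ => by simp only [hcoord]
  rw [hlevel] at h5
  rw [hdeep]
  refine jointBound_levelHeavy20_coord F ?_ ?_ h5
  · intro u hu
    obtain ⟨w, hw, rfl⟩ := mem_image.1 hu
    rw [LinearIsometryEquiv.norm_map]; exact hU w hw
  · intro u hu w hw huw
    obtain ⟨u', hu', rfl⟩ := mem_image.1 hu
    obtain ⟨w', hw', rfl⟩ := mem_image.1 hw
    rw [LinearIsometryEquiv.inner_map_map]
    exact hsep u' hu' w' hw' fun h => huw (by rw [h])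

end Summit.Ventures.Crystal3D.Theorems

end
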